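import Summits.Langlands.Langlands.Theorems.IrreducibilityBySelfDualityIrreducibleOffSectorMonomial
import Literature.NumberTheory.Automorphic.ReciprocityGLnRankOneProofs
import Literature.NumberTheory.Automorphic.AlgebraicityParityGL
import Literature.NumberTheory.Automorphic.AutomorphicInductionOrbitRegular
import Literature.NumberTheory.Automorphic.PairLFunctionPolesNeConjRankOne
import Literature.NumberTheory.Automorphic.PairLFunctionPolesEqConjLeTwo
import Literature.NumberTheory.Automorphic.StrongMultiplicityOneGLOne
import HarnessLib

/-!
# The MONOMIAL (CM-type) region of `IrreducibleOffSector` with automorphic hypotheses only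
(crux stmt-Langlands-14329 `IrreducibilityBySelfDuality.IrreducibleOffSector`, line `Sketch`;
`--supports` file, continuation lead c4; sequel of `…IrreducibleOffSectorMonomial`, p122296)

`…Monomial` proves: `P = AI_{E/K}(τ)` with `τ` a Galois-regular automorphic datum of `GL_1(𝔸_E)`
having an `ℓ`-adic avatar `ψ` ⇒ every `ρ` a.e.-compatible with `(P, ι)` is irreducible
(`isIrreducible_of_isAutomorphicInductionAlong_one`).  This file removes the two Galois-flavoured
hypotheses:

1. `exists_lAdicAvatar_of_isLAlgebraic_glOne` — **Weil's avatar**: an L-ALGEBRAIC automorphic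
   datum `τ` of `GL_1(𝔸_E)` has, for every `ℓ`, `ι`, an avatar `ψ : Γ_E → GL_1(ℚ̄_ℓ)`
   (`SatakeFrobCompatibleAt ι τ ψ w` a.e.): `τ` has a Hecke character `χ_τ`
   (`exists_heckeCharacter_glOne`), algebraic since `τ` is C-algebraic (= L-algebraic in odd rank,
   `IsLAlgebraic.isCAlgebraic_of_odd`; `isAlgebraic_heckeCharacter_glOne_of_isCAlgebraic`), and
   Weil's `ℓ`-adic character of `χ_τ` (`HeckeCharacter.IsAlgebraic.exists_lAdic`, PROVED in the tree)
   is unramified with Frobenius polynomial `X - ι⁻¹(χ_τ(ϖ_w))⁻¹ = arithFrobPolyOfSatake ι q_w 1 t_{τ,w}`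
   off `ℓ` and the ramification of `χ_τ` — the passage `t_{τ,w} = {χ_τ(ϖ_w)}` is
   `exists_eq_singleton_of_hasSatakeParamAt_glOne` (as in `HarrisLanTaylorThorne2016.theoremA_existence_rank_one`,
   minus its cuspidality/regularity hypotheses, which that proof never used).
2. `satakeRegular_of_cuspidal_induction` — **cuspidality ⇒ Galois-regularity** (Arthur–Clozel
   Ch. 3 Cor. 6.5 = `IsAutomorphicInductionAlong.not_eventually_hasSatakeParamAt_smul_of_cuspidal`):
   if `P` is CUSPIDAL then the inducing `τ` is Galois-regular, GRANTED Jacquet–Shalika (2.3) in the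
   rank `n` of `P` over `K` at every automorphic measure (`JacquetShalika1981_partialPairL_pole_of_eq_conj`,
   the `L²` leaf the line's `stub_js23` hangs on); the three rank-one inputs over `E` ((2.2), (2.3),
   multiplicity one) are theorems of the tree (`…_at_one_of_ne_conj_one`,
   `…_pole_of_eq_conj_holds_of_le_two`, `multiplicity_one_gl_one`).  In rank `n ≤ 2` the (2.3) input
   is itself a theorem, so for CM forms `π(χ)` on `GL_2` NOTHING is assumed
   (`isIrreducible_of_isAutomorphicInductionAlong_one_of_le_two`).

Consequences: `isIrreducible_of_isAutomorphicInductionAlong_one_of_isLAlgebraic` (avatar removed),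
`isIrreducible_of_cuspidal_isAutomorphicInductionAlong_one` (both removed, modulo (2.3) in rank `n`),
`isIrreducible_of_isAutomorphicInductionAlong_one_of_le_two` (rank `≤ 2`, unconditional), and the
crux's binder shape `irreducibleOffSector_conclusion_of_monomial`: for every `n ≥ 1`, `K`, every
cuspidal `π` on `GL_n(𝔸_K)` automorphically induced from a Galois-regular L-algebraic datum `τ` of
`GL_1(𝔸_E)`, `E/K` Galois, every a.e.-compatible `ρ` is irreducible — the guard, the
L-algebraicity of `π` and the off-sector clause are idle and no reciprocity input is used.

References: A. Weil, *On a certain type of characters of the idèle-class group of an algebraic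
number-field* (1956); J. Arthur, L. Clozel, Ann. of Math. Stud. 120 (1989), Ch. 3, Def. 6.1,
Lemma 6.4, Cor. 6.5; H. Jacquet, J. Shalika, Amer. J. Math. 103 (1981), (2.2)–(2.3) as in
Arthur–Clozel Ch. 3 §2.
-/

noncomputable section

set_option linter.dupNamespace false

open scoped NumberField Classical Matrix Polynomial
open Filter IsDedekindDomain Polynomial MeasureTheory
open Literature.NumberTheory.Automorphic Literature.NumberTheory.GaloisRepresentations
open Summit.Langlands

namespace Summit.Langlands.Langlands.Theorems.IrreducibleOffSector

/-! ## 1. Weil: the `ℓ`-adic avatar of an L-algebraic datum of `GL_1` -/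

section Avatar

variable {E : Type} [Field E] [NumberField E] {h1 : isCompact_glFiniteIntegralLevel 1 E}
  {ℓ : ℕ} [Fact ℓ.Prime]

/-- **The `ℓ`-adic avatar of an L-algebraic automorphic datum of `GL_1(𝔸_E)`** (Weil 1956):
if `τ` is L-algebraic then for every `ι : ℚ̄_ℓ ≃ ℂ` there is `ψ : Γ_E → GL_1(ℚ̄_ℓ)` with
`SatakeFrobCompatibleAt ι τ ψ w` at all but finitely many `w` (namely off `ℓ` and the level of
`τ`): the Hecke character `χ_τ` of `τ` is algebraic and Weil's `ℓ`-adic character of `χ_τ` has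
Frobenius polynomial `X - ι⁻¹(χ_τ(ϖ_w))⁻¹ = arithFrobPolyOfSatake ι q_w 1 {χ_τ(ϖ_w)}`, while
`t_{τ,w} = {χ_τ(ϖ_w)}`.  [cite: Weil1956, §1–§2]
[cite: HarrisLanTaylorThorneRMS2016, Thm. 7.13, p. 232 ("in the case n = 1 the result is well known")] -/
theorem exists_lAdicAvatar_of_isLAlgebraic_glOne (τ : AutomorphicRepData (AutomorphyDatum.gl 1 E h1))
    (hτ : τ.IsLAlgebraic) (ι : PadicAlgCl ℓ ≃+* ℂ) :
    ∃ ψ : FramedGaloisRep E (PadicAlgCl ℓ) 1,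
      ∀ᶠ w : HeightOneSpectrum (𝓞 E) in cofinite, SatakeFrobCompatibleAt ι τ ψ w := by
  classical
  obtain ⟨χ, hχ⟩ := τ.exists_heckeCharacter_glOne
  have halg : χ.IsAlgebraic :=
    τ.isAlgebraic_heckeCharacter_glOne_of_isCAlgebraic hχ (hτ.isCAlgebraic_of_odd odd_one)
  obtain ⟨r, hr⟩ := halg.exists_lAdic ι
  refine ⟨r, ?_⟩
  -- off `ℓ` (finitely many places: the prime factors of `(ℓ)`) and where `τ` is unramified (Flath)
  have hℓ : ∀ᶠ w : HeightOneSpectrum (𝓞 E) in cofinite, ((ℓ : ℕ) : 𝓞 E) ∉ w.asIdeal := by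
    have hne : (Ideal.span {((ℓ : ℕ) : 𝓞 E)} : Ideal (𝓞 E)) ≠ ⊥ := by
      rw [Ne, Ideal.span_singleton_eq_bot, Nat.cast_eq_zero]
      exact (Fact.out : ℓ.Prime).ne_zero
    rw [Filter.eventually_cofinite]
    refine (Ideal.finite_factors hne).subset fun w hw ↦ ?_
    simp only [Set.mem_setOf_eq, not_not] at hw ⊢
    exact (Ideal.dvd_span_singleton).mpr hw
  have hSat : ∀ᶠ w : HeightOneSpectrum (𝓞 E) in cofinite, ∃ α : Multiset ℂ, τ.HasSatakeParamAt w α :=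
    τ.hasSatakeParamAt_cofinite_holds
  filter_upwards [hℓ, hSat] with w hwℓ hw
  obtain ⟨α, hα⟩ := hw
  have hur : χ.IsUnramifiedAt w := τ.isUnramifiedAt_heckeCharacter_glOne hχ hα
  obtain ⟨hunr, hfrob⟩ := hr w hwℓ hur
  refine ⟨α, hα, hunr, ?_⟩
  obtain ⟨ϖ, hϖ, rfl⟩ := τ.exists_eq_singleton_of_hasSatakeParamAt_glOne hχ hα
  have hc : ((χ (localUnits w ϖ) : ℂˣ) : ℂ) = χ.valueAtUniformizer w := by
    rw [← HeckeCharacter.localComponent_eq_valueAtUniformizer hur hϖ,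
      HeckeCharacter.localComponent_apply]
  rw [arithFrobPolyOfSatake_one, Multiset.map_singleton, Multiset.prod_singleton, hc]
  exact hfrob

end Avatar

/-! ## 2. Arthur–Clozel Cor. 6.5: cuspidality of the induction makes `τ` Galois-regular -/

section Regular

variable {K E : Type} [Field K] [NumberField K] [Field E] [NumberField E] [Algebra K E]
  [IsGalois K E] {n : ℕ} {hK : isCompact_glFiniteIntegralLevel n K}
  {h1 : isCompact_glFiniteIntegralLevel 1 E}

/-- **Cuspidality of `P = AI_{E/K}(τ)` forces `τ` to be Galois-regular** (Arthur–Clozel 1989,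
Ch. 3, Cor. 6.5 with Lemma 6.4), for `τ` a cuspidal datum of `GL_1(𝔸_E)`: for `g ≠ 1` in
`Gal(E/K)` it is false that `t_{τ, g w} = t_{τ, w}` for almost all `w`.  This is
`IsAutomorphicInductionAlong.not_eventually_hasSatakeParamAt_smul_of_cuspidal` with its three
rank-one inputs over `E` DISCHARGED by theorems of the tree — (2.2)
`JacquetShalika1981_partialPairL_at_one_of_ne_conj_one`, (2.3)
`JacquetShalika1981_partialPairL_pole_of_eq_conj_holds_of_le_two`, multiplicity one
`multiplicity_one_gl_one` — leaving only Jacquet–Shalika (2.3) in the rank `n` of `P` over `K`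
(hypothesis `h23K`, the `L²` leaf `JacquetShalika1981_partialPairL_pole_of_eq_conj`; a theorem for
`n ≤ 2`). [cite: ArthurClozelAMS120, Ch. 3, Lemma 6.4 and Cor. 6.5] -/
theorem satakeRegular_of_cuspidal_induction
    (h23K : ∀ (μ : Measure (AdelicGroupData.gl n K).automorphicQuotient)
      [(AdelicGroupData.gl n K).IsAutomorphicMeasure μ],
      JacquetShalika1981_partialPairL_pole_of_eq_conj (n := n) (K := K) (μ := μ))
    (τ : CuspidalAutomorphicRepData 1 E h1) (P : CuspidalAutomorphicRepData n K hK)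
    (hAI : IsAutomorphicInductionAlong τ.1 P.1) :
    ∀ g : E ≃ₐ[K] E, g ≠ 1 →
      ¬ ∀ᶠ w : HeightOneSpectrum (𝓞 E) in cofinite, ∀ α : Multiset ℂ,
          τ.1.HasSatakeParamAt w α → τ.1.HasSatakeParamAt (g • w) α :=
  fun _ hg ↦ hAI.not_eventually_hasSatakeParamAt_smul_of_cuspidal one_pos h23K
    (fun _ _ ↦ JacquetShalika1981_partialPairL_at_one_of_ne_conj_one)
    (fun _ _ ↦ JacquetShalika1981_partialPairL_pole_of_eq_conj_holds_of_le_two one_le_two)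
    (fun ν _ ↦ multiplicity_one_gl_one E ν) hg

end Regular

/-! ## 3. The monomial region with automorphic hypotheses -/

section Main

variable {K E : Type} [Field K] [NumberField K] [Field E] [NumberField E] [Algebra K E]
  [IsGalois K E] {n ℓ : ℕ} [Fact ℓ.Prime] {hK : isCompact_glFiniteIntegralLevel n K}
  {h1 : isCompact_glFiniteIntegralLevel 1 E}

/-- **The monomial region, avatar hypothesis removed**: `P = AI_{E/K}(τ)` with `τ` an L-ALGEBRAIC,
Galois-regular automorphic datum of `GL_1(𝔸_E)` ⇒ every `ρ : Γ_K → GL_n(ℚ̄_ℓ)` a.e.-compatible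
with `(P, ι)` is irreducible (`isIrreducible_of_isAutomorphicInductionAlong_one` with Weil's avatar
`exists_lAdicAvatar_of_isLAlgebraic_glOne`).  Unconditional; every `n`, `K`, regular or not.
[cite: ArthurClozelAMS120, Ch. 3 Def. 6.1 and Lemma 6.4] [cite: Weil1956, §1–§2] -/
theorem isIrreducible_of_isAutomorphicInductionAlong_one_of_isLAlgebraic (ι : PadicAlgCl ℓ ≃+* ℂ)
    (τ : AutomorphicRepData (AutomorphyDatum.gl 1 E h1)) (hτ : τ.IsLAlgebraic)
    (P : AutomorphicRepData (AutomorphyDatum.gl n K hK)) (hAI : IsAutomorphicInductionAlong τ P)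
    (hreg : ∀ g : E ≃ₐ[K] E, g ≠ 1 →
      ¬ ∀ᶠ w : HeightOneSpectrum (𝓞 E) in cofinite, ∀ α : Multiset ℂ,
          τ.HasSatakeParamAt w α → τ.HasSatakeParamAt (g • w) α)
    (ρ : FramedGaloisRep K (PadicAlgCl ℓ) n)
    (hρ : ∀ᶠ v : HeightOneSpectrum (𝓞 K) in cofinite, SatakeFrobCompatibleAt ι P ρ v) :
    ρ.toGaloisRep.IsIrreducible := by
  obtain ⟨ψ, hψ⟩ := exists_lAdicAvatar_of_isLAlgebraic_glOne τ hτ ι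
  exact isIrreducible_of_isAutomorphicInductionAlong_one ι τ P hAI hreg ψ hψ ρ hρ

/-- **The monomial region for CUSPIDAL `P`, modulo Jacquet–Shalika (2.3) in rank `n` over `K`**:
`P` cuspidal on `GL_n(𝔸_K)` automorphically induced from an L-algebraic cuspidal datum `τ` of
`GL_1(𝔸_E)` (`E/K` Galois) ⇒ every `ρ` a.e.-compatible with `(P, ι)` is irreducible; Galois
regularity of `τ` comes from the cuspidality of `P` (`satakeRegular_of_cuspidal_induction`,
Arthur–Clozel Cor. 6.5), granted `JacquetShalika1981_partialPairL_pole_of_eq_conj` in rank `n`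
over `K` — the same `L²` leaf as the line's stub `stub_js23`.
[cite: ArthurClozelAMS120, Ch. 3, Def. 6.1, Lemma 6.4 and Cor. 6.5] -/
theorem isIrreducible_of_cuspidal_isAutomorphicInductionAlong_one
    (h23K : ∀ (μ : Measure (AdelicGroupData.gl n K).automorphicQuotient)
      [(AdelicGroupData.gl n K).IsAutomorphicMeasure μ],
      JacquetShalika1981_partialPairL_pole_of_eq_conj (n := n) (K := K) (μ := μ))
    (ι : PadicAlgCl ℓ ≃+* ℂ) (τ : CuspidalAutomorphicRepData 1 E h1) (hτ : τ.1.IsLAlgebraic)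
    (P : CuspidalAutomorphicRepData n K hK) (hAI : IsAutomorphicInductionAlong τ.1 P.1)
    (ρ : FramedGaloisRep K (PadicAlgCl ℓ) n)
    (hρ : ∀ᶠ v : HeightOneSpectrum (𝓞 K) in cofinite, SatakeFrobCompatibleAt ι P.1 ρ v) :
    ρ.toGaloisRep.IsIrreducible :=
  isIrreducible_of_isAutomorphicInductionAlong_one_of_isLAlgebraic ι τ.1 hτ P.1 hAI
    (satakeRegular_of_cuspidal_induction h23K τ P hAI) ρ hρ

/-- **Rank `≤ 2`: CM forms, unconditionally.**  For `n ≤ 2` Jacquet–Shalika (2.3) over `K` is a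
theorem of the tree (`JacquetShalika1981_partialPairL_pole_of_eq_conj_holds_of_le_two`), so: every
cuspidal `P` on `GL_n(𝔸_K)`, `n ≤ 2`, automorphically induced from an L-algebraic cuspidal datum
`τ` of `GL_1(𝔸_E)` (`E/K` Galois; for `n = 2`: the cuspidal `π(χ)` of an algebraic Hecke
character `χ` of a quadratic extension — all CM forms, regular or not, in particular the partial
weight one Hilbert CM forms outside the Galois-type region) has only irreducible a.e.-compatible
`ρ : Γ_K → GL_n(ℚ̄_ℓ)`, for every `ℓ`, `ι`.  Nothing is assumed.
[cite: ArthurClozelAMS120, Ch. 3, Def. 6.1, Lemma 6.4 and Cor. 6.5] -/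
theorem isIrreducible_of_isAutomorphicInductionAlong_one_of_le_two (hn : n ≤ 2)
    (ι : PadicAlgCl ℓ ≃+* ℂ) (τ : CuspidalAutomorphicRepData 1 E h1) (hτ : τ.1.IsLAlgebraic)
    (P : CuspidalAutomorphicRepData n K hK) (hAI : IsAutomorphicInductionAlong τ.1 P.1)
    (ρ : FramedGaloisRep K (PadicAlgCl ℓ) n)
    (hρ : ∀ᶠ v : HeightOneSpectrum (𝓞 K) in cofinite, SatakeFrobCompatibleAt ι P.1 ρ v) :
    ρ.toGaloisRep.IsIrreducible :=
  isIrreducible_of_cuspidal_isAutomorphicInductionAlong_one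
    (fun _ _ ↦ JacquetShalika1981_partialPairL_pole_of_eq_conj_holds_of_le_two hn) ι τ hτ P hAI ρ hρ

end Main

/-! ## 4. The region in the crux's binder shape -/

section Shape

/-- **The monomial region in the crux's binder shape.**  For every `n ≥ 1`, `K`, and every
cuspidal `π` on `GL_n(𝔸_K)` that is automorphically induced (`IsAutomorphicInductionAlong`,
Arthur–Clozel Ch. 3 Def. 6.1) from an L-ALGEBRAIC, GALOIS-REGULAR automorphic datum `τ` of
`GL_1(𝔸_E)`, `E/K` finite Galois: every `ρ : Γ_K → GL_n(ℚ̄_ℓ)` a.e.-compatible with `(π, ι)` is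
irreducible, for every `ℓ`, `ι` — the guard `0 < n`, the L-algebraicity of `π` and the off-sector
clause of `IrreducibleOffSector` are idle, and no reciprocity input (items 14328/13622, JS (2.3))
enters.  (Galois regularity of `τ` is automatic from the cuspidality of `π` granted JS (2.3) in
rank `n` over `K`, `satakeRegular_of_cuspidal_induction`; unconditionally so for `n ≤ 2`.)
[cite: ArthurClozelAMS120, Ch. 3 Def. 6.1 and Lemma 6.4] [cite: Weil1956, §1–§2] -/
theorem irreducibleOffSector_conclusion_of_monomial :
    ∀ (n : ℕ) (K : Type) [Field K] [NumberField K] (hcpt : isCompact_glFiniteIntegralLevel n K),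
      0 < n → ∀ (π : CuspidalAutomorphicRepData n K hcpt),
        (∃ (E : Type) (_ : Field E) (_ : NumberField E) (_ : Algebra K E) (_ : IsGalois K E)
            (h1 : isCompact_glFiniteIntegralLevel 1 E)
            (τ : AutomorphicRepData (AutomorphyDatum.gl 1 E h1)),
          τ.IsLAlgebraic ∧ IsAutomorphicInductionAlong τ π.1 ∧
          ∀ g : E ≃ₐ[K] E, g ≠ 1 →
            ¬ ∀ᶠ w : HeightOneSpectrum (𝓞 E) in cofinite, ∀ α : Multiset ℂ,
                τ.HasSatakeParamAt w α → τ.HasSatakeParamAt (g • w) α) →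
        π.1.IsLAlgebraic →
        ¬ (n = 3 ∧ NumberField.IsCMField K ∧
            ∃ T : InfinityType K n, π.1.HasInfinityType T ∧ T.IsRegular) →
        ∀ (ℓ : ℕ) [Fact ℓ.Prime] (ι : PadicAlgCl ℓ ≃+* ℂ) (ρ : FramedGaloisRep K (PadicAlgCl ℓ) n),
          (∀ᶠ v : HeightOneSpectrum (𝓞 K) in cofinite, SatakeFrobCompatibleAt ι π.1 ρ v) →
            ρ.toGaloisRep.IsIrreducible := by
  intro n K _ _ hcpt _ π hmono _ _ ℓ _ ι ρ hρ
  obtain ⟨E, _, _, _, _, h1, τ, hτ, hAI, hreg⟩ := hmono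
  exact isIrreducible_of_isAutomorphicInductionAlong_one_of_isLAlgebraic ι τ hτ π.1 hAI hreg ρ hρ

end Shape

end Summit.Langlands.Langlands.Theorems.IrreducibleOffSector

end
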